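import Summits.BirchSwinnertonDyer.BirchSwinnertonDyer.Theorems.ManinLocalTwoThreeConductorTwentySeven
import Summits.BirchSwinnertonDyer.BirchSwinnertonDyer.Theorems.ManinLocalTwoThreeExistsMinimalOptimalDatumUnconditional
import Summits.BirchSwinnertonDyer.BirchSwinnertonDyer.Theorems.ManinLocalTwoThreeUBDSpine
import Literature.NumberTheory.Automorphic.ShimuraCurveRibetTakahashiOptimalModularityProofs
import Literature.NumberTheory.EllipticCurves.ModularCurveEtaProductsProofs
import Literature.NumberTheory.EllipticCurves.ModularCurveEtaQuotientsProofs
import Literature.NumberTheory.EllipticCurves.ModularCurveSturmProofs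
import HarnessLib

/-!
# C3's hypothesis type at the additive level `N = 27`: inhabited ⟸ modularity, and FACT-FREE modulo ONE `q`-series identity
(route `ManinLocalTwoThree`, crux C3 `ManinPrimeToThreeAtNine` stmt-BirchSwinnertonDyer-22968; cell bsd-f2-manin, prover seat p3 gen 22;
`--supports stmt-BirchSwinnertonDyer-22968`)

C3 = `facts → exists_isNewformOf → ∀ W [min] {N} (D : X₀(N)-datum of W), lattice clause → 3² ∣ N → 3 ∤ c₀`, and the cell's conditional closer
`CDivisionInt.maninPrimeToThreeAtNine_of_CDTInt` (C3 ⟸ CDT) is a `∀` over lattice-optimal data at levels divisible by `9`.  p2 g24 showed C2's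
domain (`4 ∣ N`) is inhabited FACT-FREE at `N = 32` (`NonVacuity.exists_latticeOptimalDatum_thirtyTwo`, via the tree's `IsNewformOf` for the congruent
number curve).  No level divisible by `9` has a newform identity in the tree yet (-an g48 §93 is scoping `N = 27`).  This file records what IS
kernel-provable now at `N = 27 = 3³` (class `27a`, `X₀(27) = 27a1 : y² + y = x³ − 7`; conductor `27` by p3's kernel Tate certificate
`LevelTwentySeven.conductorNorm_twentySevenA1`):

* §1 **C3's ∀-domain is inhabited at `N = 27` GIVEN THE ITEM'S OWN BINDER `exists_isNewformOf`** (`maninPrimeToThreeAtNine_domain_inhabited_of_modularity`):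
  modularity at `W = 27a1` (conductor `27`, kernel) ⟹ a newform `f ∈ S₂(Γ₀(27))` of `W` ⟹ an `X₀(27)`-datum (Literature's fact-free
  `nonempty_modularParametrizationData_of_isNewformOf`) ⟹ a LATTICE-OPTIMAL datum on a global minimal model in the class (p2 g24's unconditional EXO
  `ExistsMinimalOptimalDatum.existsMinimalOptimalDatum_full`).  So C3 is not vacuously true relative to its hypotheses.
* §2 FACT-FREE: **the newform at level `27` is pinned** — `S₂(Γ₀(27))` is the line spanned by `φ₂₇ = η(3τ)²η(9τ)²` (tree:
  `finrank_cuspForm_two_eq_genusX0_twentySeven`, `cuspFormEtaProductTwentySeven`), `a₁(φ₂₇) = 1` (`cuspCoeff_one_etaProductTwentySeven`, from the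
  `η`-quotient asymptotics `φ₂₇/q → 1` and the general `cuspCoeff_one_eq_of_tendsto`), every form of level `27` is new (`S₂(Γ₀(M)) = 0`, `M ∣ 9`) and
  Hecke-eigen (dimension one), hence **`isNewform0_etaProductTwentySeven : IsNewform0 φ₂₇`**, `eq_etaProductTwentySeven_of_isNewform0` (the ONLY newform
  of level `27`) and `f_eq_etaProductTwentySeven` (EVERY `X₀(27)`-datum of EVERY curve has `D.f = φ₂₇`).
* §3 **the one-identity reduction**: `nonempty_datum_twentySeven_iff` — an `X₀(27)`-datum of some elliptic `W` exists IFF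
  `∀ n, aₙ(φ₂₇) = aₙ(W)` for some elliptic `W` (`⟸`: `IsNewformOf` + the fact-free datum package; `⟹`: `D.isNewformOf` with §2); and
  `exists_latticeOptimalDatum_twentySeven_of_cuspCoeff_eq` — that identity for ANY elliptic `W` yields a lattice-optimal datum on a global minimal model
  at level `27`, i.e. the fact-free C3-domain witness.  This is the exact plug for -an g48's §93 (`aₙ(η(3τ)²η(9τ)²) = aₙ(27a)`).
* §4 the conditional headline rows SAY SOMETHING at `27`: under {CDT, `exists_isNewformOf`} there is a lattice-optimal `X₀(27)`-datum and EVERY such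
  datum has `3 ∤ c₀` and `|c₀| = 1` (`…_of_CDT_of_modularity`).

HONEST FRAMING: §1 and §4 are CONDITIONAL on `exists_isNewformOf` (modularity, printed, statement-only) resp. {CDT, modularity}; §2–§3 are
unconditional.  The identity `aₙ(φ₂₇) = aₙ(27a1)` is NOT proved here (it is the open half of the fact-free witness); nothing here computes `c₀(27a)`
unconditionally, proves C3, Manin's conjecture or BSD; the items stay OPEN as filed.  No definition, no named fact, no sorry.
[cite: CremonaAlgorithms1997, Table 1 (27a1) and Table 3 (`S₂(Γ₀(27))`)] [cite: DiamondShurman2005, Thm. 3.5.1, Prop. 5.8.4, Thm. 8.8.3]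
[cite: Koehler2011, §1 (η-quotients) — `η(3τ)²η(9τ)²`] [cite: EdixhovenManin1991, Prop. 2] [cite: CalegariDimitrovTang2025, Thm. 1]
-/

set_option autoImplicit false
-- lint-debt: the directory name repeats the summit name (sibling precedent `ManinLocalTwoThreeManinOddAtFourInhabited.lean`)
set_option linter.dupNamespace false

noncomputable section

open scoped MatrixGroups ModularForm Topology
open Filter CongruenceSubgroup WeierstrassCurve Function
open UpperHalfPlane hiding I
open Literature.NumberTheory.EllipticCurves Literature.NumberTheory.EllipticCurves.ModularForms
open Literature.NumberTheory.Automorphic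

namespace Summit.BirchSwinnertonDyer.BirchSwinnertonDyer.Theorems.ManinLocalTwoThree.NonVacuityTwentySeven

/-! ## §1 C3's ∀-domain at `N = 27` is inhabited, GIVEN `exists_isNewformOf` -/

/-- **Modularity at `27a1`, levelled**: under `exists_isNewformOf` the curve `y² + y = x³ − 7` has a newform in `S₂(Γ₀(27))` (its conductor IS `27`,
kernel certificate `LevelTwentySeven.conductorNorm_twentySevenA1`).  CONDITIONAL on modularity. [cite: DiamondShurman2005, Thm. 8.8.3] -/
theorem exists_isNewformOf_twentySevenA1 (hnf : exists_isNewformOf) : ∃ f : CuspForm (Gamma0 27) 2, IsNewformOf (⟨0, 0, 1, 0, -7⟩ : WeierstrassCurve ℚ) f := by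
  haveI := LevelTwentySeven.isElliptic_twentySevenA1
  have key : ∀ (N : ℕ) [NeZero N], (⟨0, 0, 1, 0, -7⟩ : WeierstrassCurve ℚ).conductorNorm ℤ = N → ∃ f : CuspForm (Gamma0 N) 2, IsNewformOf (⟨0, 0, 1, 0, -7⟩ : WeierstrassCurve ℚ) f := by
    intro N _ hN
    subst hN
    exact hnf _
  haveI : NeZero (27 : ℕ) := ⟨by decide⟩
  exact key 27 LevelTwentySeven.conductorNorm_twentySevenA1

/-- **An `X₀(27)`-datum of `27a1` exists under modularity** (Literature's fact-free datum package `nonempty_modularParametrizationData_of_isNewformOf`: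
uniformisation, Manin constant, modular degree — all PROVED there).  CONDITIONAL on `exists_isNewformOf` only. [cite: DiamondShurman2005, Thm. 8.8.3]
[cite: EdixhovenManin1991, Prop. 2] -/
theorem nonempty_modularParametrizationData_twentySevenA1 (hnf : exists_isNewformOf) :
    Nonempty (ModularParametrizationData (⟨0, 0, 1, 0, -7⟩ : WeierstrassCurve ℚ) 27) := by
  haveI := LevelTwentySeven.isElliptic_twentySevenA1
  haveI : NeZero (27 : ℕ) := ⟨by decide⟩
  obtain ⟨f, hf⟩ := exists_isNewformOf_twentySevenA1 hnf
  exact nonempty_modularParametrizationData_of_isNewformOf hf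

/-- **A lattice-optimal `X₀(27)`-datum on a global minimal model in the class `27a` exists under modularity** (p2 g24's unconditional EXO moves the
datum of §1 to the strong Weil curve).  CONDITIONAL on `exists_isNewformOf` only. [cite: EdixhovenManin1991, Prop. 2] [cite: DiamondShurman2005, Thm. 8.8.3] -/
theorem exists_latticeOptimalDatum_twentySeven_of_modularity (hnf : exists_isNewformOf) :
    ∃ (W₀ : WeierstrassCurve ℚ) (_ : W₀.IsElliptic) (_ : W₀.IsGloballyMinimal) (D₀ : ModularParametrizationData W₀ 27),
      (⟨0, 0, 1, 0, -7⟩ : WeierstrassCurve ℚ).IsIsogenous W₀ ∧ ∀ z ∈ D₀.L.lattice, ∃ w ∈ periodLattice D₀.f, z = D₀.c * w := by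
  haveI := LevelTwentySeven.isElliptic_twentySevenA1
  haveI : NeZero (27 : ℕ) := ⟨by decide⟩
  obtain ⟨D⟩ := nonempty_modularParametrizationData_twentySevenA1 hnf
  obtain ⟨W₀, h₀, hmin, D₀, -, hiso, hopt, -⟩ := ExistsMinimalOptimalDatum.existsMinimalOptimalDatum_full (⟨0, 0, 1, 0, -7⟩ : WeierstrassCurve ℚ) D
  exact ⟨W₀, h₀, hmin, D₀, hiso, hopt⟩

/-- **C3's ∀-DOMAIN IS INHABITED AT THE ADDITIVE LEVEL `27`, given the item's own binder `exists_isNewformOf`**: literally C3's binder block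
(globally minimal `W₀`, `X₀(N)`-datum with the lattice clause, `3² ∣ N`) at `N = 27`.  So the conditional closer «C3 ⟸ CDT» is not a statement about
an empty domain (relative to the item's hypotheses).  CONDITIONAL on `exists_isNewformOf`; FACT-FREE version: §3 modulo one identity.
[cite: DiamondShurman2005, Thm. 8.8.3] [cite: EdixhovenManin1991, Prop. 2] -/
theorem maninPrimeToThreeAtNine_domain_inhabited_of_modularity (hnf : exists_isNewformOf) :
    ∃ (W₀ : WeierstrassCurve ℚ) (_ : W₀.IsElliptic) (_ : W₀.IsGloballyMinimal) (D₀ : ModularParametrizationData W₀ 27),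
      (∀ z ∈ D₀.L.lattice, ∃ w ∈ periodLattice D₀.f, z = D₀.c * w) ∧ 3 ^ 2 ∣ 27 := by
  obtain ⟨W₀, h₀, hmin, D₀, -, hopt⟩ := exists_latticeOptimalDatum_twentySeven_of_modularity hnf
  exact ⟨W₀, h₀, hmin, D₀, hopt, LevelTwentySeven.three_sq_dvd_twentySeven⟩

/-! ## §2 FACT-FREE: the newform at level `27` is `φ₂₇ = η(3τ)²η(9τ)²` -/

/-- **The first Fourier coefficient from the leading asymptotics** (general, any level): if `f(τ)/q → L` as `Im τ → ∞` (`q = e^{2πiτ}`) for a cusp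
form `f ∈ S₂(Γ₀(N))`, then `a₁(f) = L` — the cusp function `F` (`f = F ∘ q`) is analytic at `0` with `F(0) = 0`, so `F(q)/q → F′(0) = a₁`.
[cite: DiamondShurman2005, §1.1] -/
theorem cuspCoeff_one_eq_of_tendsto {N : ℕ} (f : CuspForm (Gamma0 N) 2) {L : ℂ}
    (hL : Tendsto (fun τ : ℍ ↦ f τ / Periodic.qParam 1 (τ : ℂ)) atImInfty (𝓝 L)) : cuspCoeff f 1 = L := by
  have hΓ := one_mem_strictPeriods_coe_gamma0 N
  have hper : Periodic (⇑f ∘ ofComplex) 1 := SlashInvariantFormClass.periodic_comp_ofComplex f hΓ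
  have han : AnalyticAt ℂ (cuspFunction 1 ⇑f) 0 := ModularFormClass.analyticAt_cuspFunction_zero f one_pos hΓ
  have h0 : cuspFunction 1 ⇑f 0 = 0 := CuspFormClass.cuspFunction_apply_zero f one_pos hΓ
  have hd : HasDerivAt (cuspFunction 1 ⇑f) (deriv (cuspFunction 1 ⇑f) 0) 0 := han.differentiableAt.hasDerivAt
  have hq : Tendsto (fun τ : ℍ ↦ Periodic.qParam 1 (τ : ℂ)) atImInfty (𝓝[≠] 0) :=
    tendsto_nhdsWithin_iff.mpr ⟨qParam_tendsto_atImInfty one_pos,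
      Eventually.of_forall fun τ ↦ by simp [Periodic.qParam]⟩
  have hslope := hd.tendsto_slope_zero.comp hq
  have heq : ((fun t : ℂ ↦ t⁻¹ • (cuspFunction 1 ⇑f (0 + t) - cuspFunction 1 ⇑f 0)) ∘ fun τ : ℍ ↦ Periodic.qParam 1 (τ : ℂ)) =
      fun τ : ℍ ↦ f τ / Periodic.qParam 1 (τ : ℂ) := by
    funext τ
    simp only [Function.comp_apply, zero_add, h0, sub_zero, smul_eq_mul, eq_cuspFunction τ one_ne_zero hper]
    rw [div_eq_inv_mul]
  rw [heq] at hslope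
  have hlim : deriv (cuspFunction 1 ⇑f) 0 = L := tendsto_nhds_unique hslope hL
  rw [cuspCoeff, qExpansion_coeff, iteratedDeriv_one, Nat.factorial_one, Nat.cast_one, inv_one, one_mul]
  exact hlim

/-- The exponent vector of `η(3τ)²η(9τ)²` as an `η`-quotient of level `27` (`r₃ = r₉ = 2`, else `0`). [cite: Koehler2011, §1] -/
theorem etaProductTwentySeven_eq_etaQuotient (τ : ℍ) :
    etaProductTwentySeven τ = etaQuotient 27 (fun δ ↦ if δ = 3 ∨ δ = 9 then 2 else 0) τ := by
  rw [etaProductTwentySeven_apply, etaQuotient_apply, show Nat.divisors 27 = {1, 3, 9, 27} by decide]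
  simp [Finset.prod_insert, zpow_ofNat]

/-- **`φ₂₇(τ)/q → 1` at `i∞`**: the order of `η(3τ)²η(9τ)²` at `∞` is `(3·2 + 9·2)/24 = 1` with leading coefficient `1`
(tree `tendsto_etaQuotient_div_qParam_zpow`). [cite: Koehler2011, §1] -/
theorem tendsto_etaProductTwentySeven_div_qParam :
    Tendsto (fun τ : ℍ ↦ cuspFormEtaProductTwentySeven τ / Periodic.qParam 1 (τ : ℂ)) atImInfty (𝓝 1) := by
  have h := tendsto_etaQuotient_div_qParam_zpow 27 (fun δ ↦ if δ = 3 ∨ δ = 9 then 2 else 0) 1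
    (by rw [show Nat.divisors 27 = {1, 3, 9, 27} by decide]; simp [Finset.sum_insert])
  refine h.congr fun τ ↦ ?_
  rw [zpow_one, ← etaProductTwentySeven_eq_etaQuotient]
  rfl

/-- **`a₁(φ₂₇) = 1`**: `η(3τ)²η(9τ)² = q − 2q⁴ − q⁷ + ⋯` is normalised. [cite: CremonaAlgorithms1997, Table 3 (N = 27)] [cite: Koehler2011, §1] -/
theorem cuspCoeff_one_etaProductTwentySeven : cuspCoeff cuspFormEtaProductTwentySeven 1 = 1 :=
  cuspCoeff_one_eq_of_tendsto _ tendsto_etaProductTwentySeven_div_qParam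

/-- `φ₂₇` is normalised (`IsNormalized`). [cite: CremonaAlgorithms1997, Table 3 (N = 27)] -/
theorem isNormalized_etaProductTwentySeven : IsNormalized cuspFormEtaProductTwentySeven :=
  cuspCoeff_one_etaProductTwentySeven

/-- **Every weight-`2` cusp form of level `27` is new**: the adjoint degeneracy maps land in `S₂(Γ₀(M))`, `M ∈ {1, 3, 9}`, which vanish
(`cuspForm_two_gamma0_eq_zero_of_le_ten`, genus `0`). [cite: DiamondShurman2005, Thm. 3.5.1 and §5.6] -/
theorem mem_newSubspace0_twentySeven (f : CuspForm (Gamma0 27) 2) : f ∈ newSubspace0 27 2 := by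
  rw [newSubspace0, Submodule.mem_iInf]
  intro Md
  rw [LinearMap.mem_ker]
  have hall : ∀ M ∈ Nat.properDivisors 27, M ≤ 10 := by decide
  exact cuspForm_two_gamma0_eq_zero_of_le_ten (hall _ Md.2.1) _

/-- **Every non-zero `f ∈ S₂(Γ₀(27))` is a Hecke eigenform**: the space is a line (`finrank_cuspForm_two_eq_genusX0_twentySeven`, genus of `X₀(27)`
is `1`) stable under every `T_p`. [cite: DiamondShurman2005, Thm. 3.5.1 and Prop. 5.8.4] -/
theorem isHeckeEigenform_of_ne_zero_twentySeven {f : CuspForm (Gamma0 27) 2} (hf : f ≠ 0) : IsHeckeEigenform f := by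
  intro p hp
  haveI : NeZero p := ⟨hp.ne_zero⟩
  obtain ⟨c, hc⟩ := (finrank_eq_one_iff_of_nonzero' f hf).mp finrank_cuspForm_two_eq_genusX0_twentySeven.2.1 (heckeT _ 2 p f)
  exact ⟨c, hc.symm⟩

/-- **`φ₂₇ = η(3τ)²η(9τ)²` is a newform of weight `2` on `Γ₀(27)`** (new, Hecke eigenform, `a₁ = 1`) — FACT-FREE.
[cite: CremonaAlgorithms1997, Table 3 (N = 27)] [cite: DiamondShurman2005, Def. 5.8.1] -/
theorem isNewform0_etaProductTwentySeven : IsNewform0 cuspFormEtaProductTwentySeven :=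
  ⟨mem_newSubspace0_twentySeven _, isHeckeEigenform_of_ne_zero_twentySeven cuspFormEtaProductTwentySeven_ne_zero,
    isNormalized_etaProductTwentySeven⟩

/-- **Uniqueness: every newform of weight `2` on `Γ₀(27)` is `φ₂₇`** (the line `S₂(Γ₀(27))` contains one normalised form).
[cite: CremonaAlgorithms1997, Table 3 (N = 27)] -/
theorem eq_etaProductTwentySeven_of_isNewform0 {g : CuspForm (Gamma0 27) 2} (hg : IsNewform0 g) : g = cuspFormEtaProductTwentySeven := by
  obtain ⟨c, hc⟩ := (finrank_eq_one_iff_of_nonzero' cuspFormEtaProductTwentySeven cuspFormEtaProductTwentySeven_ne_zero).mp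
    finrank_cuspForm_two_eq_genusX0_twentySeven.2.1 g
  have h1 : cuspCoeff g 1 = 1 := hg.2.2
  have h2 : cuspCoeff cuspFormEtaProductTwentySeven 1 = 1 := cuspCoeff_one_etaProductTwentySeven
  have hc1 : c = 1 := by
    have h := congrArg (cuspCoeff · 1) hc
    simp only [cuspCoeff_smul, h1, h2, mul_one] at h
    exact h
  rw [← hc, hc1, one_smul]

/-- **Every `X₀(27)`-datum of every curve has newform `φ₂₇`** (`D.f` is a newform of level `27`).  FACT-FREE. [cite: CremonaAlgorithms1997, Table 3 (N = 27)] -/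
theorem f_eq_etaProductTwentySeven {W : WeierstrassCurve ℚ} (D : ModularParametrizationData W 27) : D.f = cuspFormEtaProductTwentySeven :=
  eq_etaProductTwentySeven_of_isNewform0 D.isNewformOf.1

/-- Hence the Fourier coefficients of `φ₂₇` ARE the `L`-series coefficients of any curve carrying an `X₀(27)`-datum. [folklore] -/
theorem cuspCoeff_etaProductTwentySeven_eq_lFunction_of_datum {W : WeierstrassCurve ℚ} (D : ModularParametrizationData W 27) (n : ℕ) :
    cuspCoeff cuspFormEtaProductTwentySeven n = (W.LFunction n : ℂ) := by
  rw [← f_eq_etaProductTwentySeven D]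
  exact D.isNewformOf.2 n

/-! ## §3 The one-identity reduction: a fact-free `N = 27` witness ⟺ `aₙ(φ₂₇) = aₙ(W)` for some elliptic `W` -/

/-- **`IsNewformOf W φ₂₇` from the coefficient identity alone** (newness, eigen-ness and `a₁ = 1` are §2). [cite: DiamondShurman2005, Def. 8.8.2] -/
theorem isNewformOf_etaProductTwentySeven_of_cuspCoeff_eq {W : WeierstrassCurve ℚ}
    (h : ∀ n : ℕ, cuspCoeff cuspFormEtaProductTwentySeven n = (W.LFunction n : ℂ)) : IsNewformOf W cuspFormEtaProductTwentySeven :=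
  ⟨isNewform0_etaProductTwentySeven, h⟩

/-- **A fact-free lattice-optimal `X₀(27)`-datum on a global minimal model, MODULO the identity `aₙ(φ₂₇) = aₙ(W)`** for one elliptic `W`
(e.g. `W = 27a1` or `27a3`, -an g48 §93): identity ⟹ `IsNewformOf` (§2) ⟹ datum (Literature package) ⟹ lattice-optimal minimal twin (EXO).
UNCONDITIONAL implication. [cite: EdixhovenManin1991, Prop. 2] [cite: DiamondShurman2005, Def. 8.8.2] -/
theorem exists_latticeOptimalDatum_twentySeven_of_cuspCoeff_eq (W : WeierstrassCurve ℚ) [W.IsElliptic]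
    (h : ∀ n : ℕ, cuspCoeff cuspFormEtaProductTwentySeven n = (W.LFunction n : ℂ)) :
    ∃ (W₀ : WeierstrassCurve ℚ) (_ : W₀.IsElliptic) (_ : W₀.IsGloballyMinimal) (D₀ : ModularParametrizationData W₀ 27),
      D₀.f = cuspFormEtaProductTwentySeven ∧ W.IsIsogenous W₀ ∧ ∀ z ∈ D₀.L.lattice, ∃ w ∈ periodLattice D₀.f, z = D₀.c * w := by
  haveI : NeZero (27 : ℕ) := ⟨by decide⟩
  obtain ⟨D⟩ := nonempty_modularParametrizationData_of_isNewformOf (isNewformOf_etaProductTwentySeven_of_cuspCoeff_eq h)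
  obtain ⟨W₀, h₀, hmin, D₀, -, hiso, hopt, -⟩ := ExistsMinimalOptimalDatum.existsMinimalOptimalDatum_full W D
  exact ⟨W₀, h₀, hmin, D₀, f_eq_etaProductTwentySeven D₀, hiso, hopt⟩

/-- **C3's binder block at `27`, fact-free modulo the identity.** [cite: EdixhovenManin1991, Prop. 2] -/
theorem maninPrimeToThreeAtNine_domain_inhabited_of_cuspCoeff_eq (W : WeierstrassCurve ℚ) [W.IsElliptic]
    (h : ∀ n : ℕ, cuspCoeff cuspFormEtaProductTwentySeven n = (W.LFunction n : ℂ)) :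
    ∃ (W₀ : WeierstrassCurve ℚ) (_ : W₀.IsElliptic) (_ : W₀.IsGloballyMinimal) (D₀ : ModularParametrizationData W₀ 27),
      (∀ z ∈ D₀.L.lattice, ∃ w ∈ periodLattice D₀.f, z = D₀.c * w) ∧ 3 ^ 2 ∣ 27 := by
  obtain ⟨W₀, h₀, hmin, D₀, -, -, hopt⟩ := exists_latticeOptimalDatum_twentySeven_of_cuspCoeff_eq W h
  exact ⟨W₀, h₀, hmin, D₀, hopt, LevelTwentySeven.three_sq_dvd_twentySeven⟩

/-- **The reduction is EXACT**: an `X₀(27)`-datum of some elliptic curve exists IFF the coefficients of `φ₂₇` are the `L`-coefficients of some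
elliptic curve over `ℚ`.  FACT-FREE. [cite: DiamondShurman2005, Def. 8.8.2] [cite: EdixhovenManin1991, Prop. 2] -/
theorem nonempty_datum_twentySeven_iff :
    (∃ (W : WeierstrassCurve ℚ) (_ : W.IsElliptic), Nonempty (ModularParametrizationData W 27)) ↔
      ∃ (W : WeierstrassCurve ℚ) (_ : W.IsElliptic), ∀ n : ℕ, cuspCoeff cuspFormEtaProductTwentySeven n = (W.LFunction n : ℂ) := by
  haveI : NeZero (27 : ℕ) := ⟨by decide⟩
  constructor
  · rintro ⟨W, hW, ⟨D⟩⟩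
    exact ⟨W, hW, cuspCoeff_etaProductTwentySeven_eq_lFunction_of_datum D⟩
  · rintro ⟨W, hW, h⟩
    exact ⟨W, hW, nonempty_modularParametrizationData_of_isNewformOf (isNewformOf_etaProductTwentySeven_of_cuspCoeff_eq h)⟩

/-- Under modularity the identity holds for `27a1` itself: `aₙ(η(3τ)²η(9τ)²) = aₙ(y² + y = x³ − 7)` for all `n` (the newform of `27a1` is a
newform of level `27`, hence `φ₂₇`).  CONDITIONAL on `exists_isNewformOf`; the fact-free proof is -an g48's §93 target.
[cite: CremonaAlgorithms1997, Table 1 (27a1) and Table 3] [cite: DiamondShurman2005, Thm. 8.8.3] -/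
theorem cuspCoeff_etaProductTwentySeven_eq_lFunction_twentySevenA1_of_modularity (hnf : exists_isNewformOf) (n : ℕ) :
    cuspCoeff cuspFormEtaProductTwentySeven n = ((⟨0, 0, 1, 0, -7⟩ : WeierstrassCurve ℚ).LFunction n : ℂ) := by
  obtain ⟨D⟩ := nonempty_modularParametrizationData_twentySevenA1 hnf
  exact cuspCoeff_etaProductTwentySeven_eq_lFunction_of_datum D n

/-! ## §4 The conditional headline rows at `N = 27` -/

/-- **Every lattice-optimal `X₀(27)`-datum of a globally minimal curve has `3 ∤ c₀`, modulo CDT** (the cell's C3 ⟸ CDT, per datum: Stevens'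
inclusion `Λ₁(f) ⊆ Λ_W` from `CDivisionInt.periodLatticeGamma1_le_neron_of_CDTInt` + the fact-free conjugation obstruction
`KummerValues.not_dvd_maninConstant_of_gamma1Periods_le`).  CONDITIONAL on CDT (printed, statement-only). [cite: CalegariDimitrovTang2025, Thm. 1]
[cite: Stevens1989, §2] -/
theorem not_three_dvd_maninConstant_twentySeven_of_CDT (hCDT : CalegariDimitrovTang2025_unboundedDenominators)
    (W₀ : WeierstrassCurve ℚ) [W₀.IsElliptic] [W₀.IsGloballyMinimal] (D₀ : ModularParametrizationData W₀ 27)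
    (hopt : ∀ z ∈ D₀.L.lattice, ∃ w ∈ periodLattice D₀.f, z = D₀.c * w) : ¬ (3 : ℤ) ∣ D₀.maninConstant :=
  haveI : NeZero (27 : ℕ) := ⟨by decide⟩
  KummerValues.not_dvd_maninConstant_of_gamma1Periods_le D₀ hopt (CDivisionInt.periodLatticeGamma1_le_neron_of_CDTInt hCDT D₀) le_rfl

/-- **Under {CDT, modularity}: a lattice-optimal `X₀(27)`-datum EXISTS and has `3 ∤ c₀` and `|c₀| = 1`** — C3's conclusion shape at the first
additive level divisible by `9`, on an inhabited domain.  CONDITIONAL on the two statement-only printed facts; `c₀(27a)` is NOT computed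
unconditionally. [cite: CalegariDimitrovTang2025, Thm. 1] [cite: DiamondShurman2005, Thm. 8.8.3] [cite: Stevens1989, §2] -/
theorem exists_datum_twentySeven_not_three_dvd_of_CDT_of_modularity (hCDT : CalegariDimitrovTang2025_unboundedDenominators)
    (hnf : exists_isNewformOf) :
    ∃ (W₀ : WeierstrassCurve ℚ) (_ : W₀.IsElliptic) (_ : W₀.IsGloballyMinimal) (D₀ : ModularParametrizationData W₀ 27),
      (∀ z ∈ D₀.L.lattice, ∃ w ∈ periodLattice D₀.f, z = D₀.c * w) ∧ ¬ (3 : ℤ) ∣ D₀.maninConstant ∧ |D₀.maninConstant| = 1 := by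
  haveI : NeZero (27 : ℕ) := ⟨by decide⟩
  obtain ⟨W₀, h₀, hmin, D₀, -, hopt⟩ := exists_latticeOptimalDatum_twentySeven_of_modularity hnf
  exact ⟨W₀, h₀, hmin, D₀, hopt, not_three_dvd_maninConstant_twentySeven_of_CDT hCDT W₀ D₀ hopt,
    UBDSpine.abs_maninConstant_eq_one_of_gamma1Periods_le_of_modularity hnf D₀ hopt
      (CDivisionInt.periodLatticeGamma1_le_neron_of_CDTInt hCDT D₀)⟩

end Summit.BirchSwinnertonDyer.BirchSwinnertonDyer.Theorems.ManinLocalTwoThree.NonVacuityTwentySeven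

end
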